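import Literature.Computability.QuantumComplexity.BQP
import HarnessLib

/-!
# `BPP ⊆ BQP`: the Hadamard coin layer and the reduction to the reversible core

Proofs towards the named fact `Literature.Computability.QuantumComplexity.BPP_subset_BQP` of
`Literature.Computability.QuantumComplexity.BQP` (Bernstein–Vazirani 1997, Thm. 8.3;
Arora–Barak 2009, Cor. 10.11), kept in a sibling file so that the statement file stays a
definitions/named-facts file.

The printed proof (BV97, p. 1451) has two halves.

* **Reversible core** (classical compilation): from `L' ∈ P` and the coin polynomial `p`, a
  polynomial-time uniform device that writes `0^{p(n)}` next to the input, applies the Fourier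
  transform (one Hadamard gate per coin wire) and then runs a *synchronized reversible* version
  of the deterministic machine `M` deciding `L'`, so that basis states go to basis states,
  `|x⟩|y⟩|0…0⟩ ↦ |x⟩|y⟩|M(x;y)⟩|…⟩`. Over Mathlib's `TM2` model underlying `Literature.Computability.Complexity.Classes.P` this
  is a Turing-machine-to-uniform-circuit compiler (Arora–Barak Thm. 6.6, Lemma 10.10) and is
  vendored here as the named fact `uniformReversibleSimulation` (not discharged).
* **Quantum half** (proved here): the coin layer produces `2^{-p(n)/2} ∑_y |x⟩|y⟩|0^m⟩`
  (`hadamardLayer_mulVec_padInput`), the classical part permutes basis states, so the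
  probability of reading `1` on wire `0` is exactly the fraction of coin strings `y` with
  `⟨x, y⟩ ∈ L'` (`coinFamily_acceptProbOn`, `uniformProb_eq_card_ofFn`); with the `2/3`–`1/3`
  gap of `BPP = BP·P` this is membership in `BQP`
  (`BPP_subset_BQP_of_uniformReversibleSimulation : uniformReversibleSimulation → BPP_subset_BQP`).

Contents: `wireEmb`, `hOn` (a placed Hadamard gate), `coinWire`/`coinWires`, `hadamardLayer`,
`coinInput` (the label `x y 0^m`), `coinFamily p m D` (Hadamard coins, then the classical part
`D n`); the lemmas `hOn_mulVec_basisState`, `hadamards_mulVec_basisState` (closed form of a layer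
of Hadamard gates on distinct wires applied to a basis state), `coinFamily_runOn`,
`coinFamily_acceptProb`, `uniformProb_compl`.

## References

* E. Bernstein, U. Vazirani, *Quantum complexity theory*, SIAM J. Comput. 26 (1997)
  1411–1473, §8.2, Thm. 8.3 (`BPP ⊆ BQP`) and its proof, p. 1451.
* S. Arora, B. Barak, *Computational Complexity: A Modern Approach*, CUP 2009, §10.3.7,
  Lemma 10.10 (Boolean circuits as quantum circuits), Cor. 10.11 (`BPP ⊆ BQP`), Thm. 6.6
  (`P` has `P`-uniform circuits).
* M. A. Nielsen, I. L. Chuang, *Quantum Computation and Quantum Information*, CUP 2010,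
  §1.3.1 (Hadamard gate), §1.4.4 (`H^{⊗n}`), §4.3, Fig. 4.9 (Toffoli from `H, S, T, CNOT`).

## Design notes

* Register layout for input length `n`: wires `0…n-1` input, `n…n+p(n)-1` coins,
  `n+p(n)…` work space, i.e. `QReg (n + (p n + m n))`, matching `padInput x (p n + m n)` of
  `QCircuit.acceptProb` definitionally; `coinFamily` is an `abbrev` so that
  `(coinFamily p m D).ancillas n` unfolds to `p n + m n` inside types.
* The reversible core is stated for the *composite* family (coins, then `D n`) because
  uniformity (`QCircuitFamily.IsUniform`, a `TM2` statement) is not yet closed under any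
  circuit surgery in the library (`Literature.Computability.Complexity.PolyTimeComputable.comp` is itself a named
  fact); everything downstream of uniformity is proved.
-/

noncomputable section

namespace Literature.Computability.QuantumComplexity

open _root_.Computability Complexity Complexity.Classes Cryptography Cryptography.ClassBQP Matrix

/-! ### The Hadamard coin layer -/

/-- The embedding `Fin 1 ↪ Fin N` selecting the single wire `i`. [folklore] -/
def wireEmb {N : ℕ} (i : Fin N) : Fin 1 ↪ Fin N :=
  ⟨fun _ => i, fun a b _ => Subsingleton.elim a b⟩

/-- `wireEmb i` selects the wire `i`. [folklore] -/
@[simp] theorem wireEmb_apply {N : ℕ} (i : Fin N) (j : Fin 1) : wireEmb i j = i := rfl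

/-- The range of `wireEmb i` is `{i}`. [folklore] -/
@[simp] theorem range_wireEmb {N : ℕ} (i : Fin N) : Set.range (wireEmb i) = {i} := by
  ext j; simp [wireEmb]

/-- The Hadamard gate of Clifford+T placed on wire `i`. [folklore] -/
def hOn {N : ℕ} (i : Fin N) : QGate cliffordT N :=
  QGate.gate CliffordTOp.H (wireEmb i)

/-- The `j`-th coin wire of a register with `n` input wires, `k` coin wires and `m` work
wires (wire `n + j`). [folklore] -/
def coinWire (n k m : ℕ) (j : Fin k) : Fin (n + (k + m)) :=
  Fin.natAdd n (Fin.castAdd m j)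

/-- Distinct coins sit on distinct wires. [folklore] -/
theorem coinWire_injective (n k m : ℕ) : Function.Injective (coinWire n k m) := by
  intro a b h
  simpa [coinWire, Fin.ext_iff] using h

/-- The list of the `k` coin wires, in order. [folklore] -/
def coinWires (n k m : ℕ) : List (Fin (n + (k + m))) :=
  (List.finRange k).map (coinWire n k m)

/-- The Hadamard coin layer: one Hadamard gate on each of the `k` coin wires
`n, n+1, …, n+k-1`. [Bernstein–Vazirani 1997, proof of Thm. 8.3 (Fourier transform on the
second track); Arora–Barak 2009, Cor. 10.11] [cite: BernsteinVazirani1997, Thm. 8.3 (proof)] -/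
def hadamardLayer (n k m : ℕ) : List (QGate cliffordT (n + (k + m))) :=
  (coinWires n k m).map hOn

/-- The basis label `x y 0^m` of a register with `n` input wires holding `x`, `k` coin wires
holding `y` and `m` work wires holding `0`. [folklore] -/
def coinInput {n k m : ℕ} (x : QReg n) (y : QReg k) : QReg (n + (k + m)) :=
  Fin.append x (Fin.append y fun _ => false)

/-- The circuit family "Hadamard coins, then the classical part `D n`": on inputs of length
`n` it uses `p n` coin wires and `m n` work wires. An `abbrev`, so that `ancillas n` unfolds
to `p n + m n` in types. [Bernstein–Vazirani 1997, proof of Thm. 8.3; Arora–Barak 2009,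
Cor. 10.11] [cite: BernsteinVazirani1997, Thm. 8.3 (proof)] -/
abbrev coinFamily (p m : ℕ → ℕ) (D : (n : ℕ) → QCircuit cliffordT (n + (p n + m n))) :
    QCircuitFamily cliffordT where
  ancillas n := p n + m n
  circ n := ⟨hadamardLayer n (p n) (m n) ++ (D n).gates⟩

/-! ### One Hadamard gate on a basis state -/

/-- The amplitude `1/√2` as a complex number. [folklore] -/
abbrev invSqrt2 : ℂ := 1 / (Real.sqrt 2 : ℂ)

/-- The first column of the Hadamard gate is `(1/√2, 1/√2)`. [Nielsen–Chuang 2010, §1.3.1]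
[cite: NielsenChuang2010, §1.3.1] -/
theorem hGate_apply_false (a : QReg 1) (b : QReg 1) (hb : b 0 = false) :
    hGate a b = invSqrt2 := by
  simp [hGate, hb]

/-- The matrix of the placed Hadamard gate `hOn i` (for any oracle) is the placement of `hGate`
on wire `i`. [folklore] -/
theorem hOn_toMatrix {N : ℕ} (A : Language Bool) (i : Fin N) :
    (hOn i).toMatrix A = placeGate (wireEmb i) hGate := rfl

/-- `hOn i` is oracle-free. [folklore] -/
theorem hOn_isOracleFree {N : ℕ} (i : Fin N) : (hOn i).IsOracleFree := trivial

/-- A Hadamard gate on wire `i` maps the basis state `|w⟩` with `w i = 0` to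
`(|w⟩ + |w[i ↦ 1]⟩)/√2`. [Nielsen–Chuang 2010, §1.3.1] [cite: NielsenChuang2010, §1.3.1] -/
theorem hOn_mulVec_basisState {N : ℕ} (i : Fin N) (w : QReg N) (hw : w i = false) :
    (hOn i).toMatrix 0 *ᵥ basisState w =
      invSqrt2 • (basisState w + basisState (Function.update w i true)) := by
  ext z
  rw [hOn_toMatrix]
  simp only [Matrix.mulVec, dotProduct, basisState_apply, mul_ite,
    mul_one, mul_zero, Finset.sum_ite_eq', Finset.mem_univ, if_true, Pi.smul_apply,
    Pi.add_apply, smul_eq_mul]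
  rw [placeGate_apply]
  have hcoin : hGate (z ∘ wireEmb i) (w ∘ wireEmb i) = invSqrt2 :=
    hGate_apply_false _ _ (by simp [hw])
  simp only [range_wireEmb, Set.mem_singleton_iff, hcoin]
  by_cases hz : ∀ l, l ≠ i → z l = w l
  · rw [if_pos (fun l hl => hz l hl)]
    by_cases hzi : z i = true
    · have h1 : z ≠ w := fun h => by rw [h, hw] at hzi; exact Bool.false_ne_true hzi
      have h2 : z = Function.update w i true := by
        funext l
        by_cases hl : l = i
        · subst hl; simp [hzi]
        · simp [hl, hz l hl]
      simp [h2, hw]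
    · have hzi' : z i = false := by simpa using hzi
      have h1 : z = w := by
        funext l
        by_cases hl : l = i
        · subst hl; rw [hzi', hw]
        · exact hz l hl
      have h2 : z ≠ Function.update w i true := fun h => by
        rw [h] at hzi'; simp at hzi'
      simp [h1, hw]
  · rw [if_neg (fun h => hz fun l hl => h l hl)]
    have h1 : z ≠ w := fun h => hz fun l _ => by rw [h]
    have h2 : z ≠ Function.update w i true := fun h => hz fun l hl => by rw [h]; simp [hl]
    simp [h1, h2]

/-! ### A layer of Hadamard gates on distinct wires -/

/-- Hadamard gates on the distinct wires `ws`, applied to a basis state `|w⟩` vanishing on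
`ws`, give the uniform superposition (amplitude `2^{-|ws|/2}`) of the basis states agreeing
with `w` off `ws`. [Nielsen–Chuang 2010, §1.4.4 (`H^{⊗n}|0⟩`)] [cite: NielsenChuang2010, §1.4.4] -/
theorem hadamards_mulVec_basisState {N : ℕ} (ws : List (Fin N)) (hws : ws.Nodup) (w : QReg N)
    (hw : ∀ i ∈ ws, w i = false) :
    (⟨ws.map hOn⟩ : QCircuit cliffordT N).toMatrix 0 *ᵥ basisState w =
      fun z => if (∀ j, j ∉ ws → z j = w j) then invSqrt2 ^ ws.length else 0 := by
  induction ws generalizing w with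
  | nil =>
    ext z
    simp only [List.map_nil, QCircuit.toMatrix_nil, Matrix.one_mulVec, basisState_apply,
      List.not_mem_nil, not_false_eq_true, forall_const, List.length_nil, pow_zero]
    simp [funext_iff]
  | cons i ws ih =>
    have hi : i ∉ ws := (List.nodup_cons.1 hws).1
    have hws' : ws.Nodup := (List.nodup_cons.1 hws).2
    have hwi : w i = false := hw i (by simp)
    have hw1 : ∀ j ∈ ws, w j = false := fun j hj => hw j (by simp [hj])
    have hw2 : ∀ j ∈ ws, Function.update w i true j = false := fun j hj => by
      have hji : j ≠ i := fun e => hi (e ▸ hj)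
      rw [Function.update_of_ne hji]; exact hw1 j hj
    ext z
    rw [List.map_cons, QCircuit.toMatrix_cons, ← Matrix.mulVec_mulVec,
      hOn_mulVec_basisState i w hwi, Matrix.mulVec_smul, Matrix.mulVec_add, ih hws' w hw1,
      ih hws' _ hw2]
    simp only [Pi.smul_apply, Pi.add_apply, smul_eq_mul, List.length_cons, pow_succ]
    by_cases hC : ∀ j, j ∉ i :: ws → z j = w j
    · rw [if_pos hC]
      by_cases hzi : z i = true
      · have hA : ¬ ∀ j, j ∉ ws → z j = w j := fun h => by
          have := h i hi; rw [hzi, hwi] at this; exact Bool.true_eq_false.mp this |>.elim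
        have hB : ∀ j, j ∉ ws → z j = Function.update w i true j := fun j hj => by
          by_cases hji : j = i
          · subst hji; simp [hzi]
          · rw [Function.update_of_ne hji]; exact hC j (by simp [hji, hj])
        rw [if_neg hA, if_pos hB]; ring
      · have hzi' : z i = false := by simpa using hzi
        have hA : ∀ j, j ∉ ws → z j = w j := fun j hj => by
          by_cases hji : j = i
          · subst hji; rw [hzi', hwi]
          · exact hC j (by simp [hji, hj])
        have hB : ¬ ∀ j, j ∉ ws → z j = Function.update w i true j := fun h => by
          have := h i hi; simp [hzi'] at this
        rw [if_pos hA, if_neg hB]; ring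
    · rw [if_neg hC]
      have hA : ¬ ∀ j, j ∉ ws → z j = w j := fun h => hC fun j hj =>
        h j (fun hj' => hj (List.mem_cons_of_mem _ hj'))
      have hB : ¬ ∀ j, j ∉ ws → z j = Function.update w i true j := fun h => hC fun j hj => by
        have hji : j ≠ i := fun e => hj (e ▸ List.mem_cons_self ..)
        rw [h j (fun hj' => hj (List.mem_cons_of_mem _ hj')), Function.update_of_ne hji]
      rw [if_neg hA, if_neg hB]; ring

/-! ### The coin layer on a padded input -/

section coins

variable {n k m : ℕ}

/-- The `j`-th coin wire is wire `n + j`. [folklore] -/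
theorem val_coinWire (j : Fin k) : (coinWire n k m j : ℕ) = n + j := by
  simp [coinWire]

/-- The coin wires are the wires `n ≤ i < n + k`. [folklore] -/
theorem mem_range_coinWire_iff (i : Fin (n + (k + m))) :
    i ∈ Set.range (coinWire n k m) ↔ n ≤ (i : ℕ) ∧ (i : ℕ) < n + k := by
  constructor
  · rintro ⟨j, rfl⟩
    rw [val_coinWire]; omega
  · rintro ⟨h1, h2⟩
    refine ⟨⟨i - n, by omega⟩, Fin.ext ?_⟩
    rw [val_coinWire]; dsimp; omega

/-- The list of coin wires has no duplicates. [folklore] -/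
theorem coinWires_nodup : (coinWires n k m).Nodup :=
  (List.nodup_finRange k).map (coinWire_injective n k m)

/-- Membership in the list of coin wires. [folklore] -/
theorem mem_coinWires_iff (i : Fin (n + (k + m))) :
    i ∈ coinWires n k m ↔ i ∈ Set.range (coinWire n k m) := by
  simp [coinWires, List.mem_map, Set.mem_range]

/-- There are `k` coin wires. [folklore] -/
@[simp] theorem length_coinWires : (coinWires n k m).length = k := by
  simp [coinWires]

/-- Input wires of `x y 0^m` hold `x`. [folklore] -/
@[simp] theorem coinInput_castAdd (x : QReg n) (y : QReg k) (i : Fin n) :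
    coinInput (m := m) x y (Fin.castAdd (k + m) i) = x i := by
  simp [coinInput]

/-- Coin wires of `x y 0^m` hold `y`. [folklore] -/
@[simp] theorem coinInput_coinWire (x : QReg n) (y : QReg k) (j : Fin k) :
    coinInput (m := m) x y (coinWire n k m j) = y j := by
  simp [coinInput, coinWire]

/-- Work wires of `x y 0^m` hold `0`. [folklore] -/
@[simp] theorem coinInput_work (x : QReg n) (y : QReg k) (l : Fin m) :
    coinInput x y (Fin.natAdd n (Fin.natAdd k l)) = false := by
  simp [coinInput]

/-- Input wires of `x 0^{k+m}` hold `x`. [folklore] -/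
@[simp] theorem padInput_castAdd' (x : QReg n) (i : Fin n) :
    padInput x (k + m) (Fin.castAdd (k + m) i) = x i := by
  simp [padInput]

/-- Non-input wires of `x 0^{k+m}` hold `0`. [folklore] -/
@[simp] theorem padInput_natAdd' (x : QReg n) (i : Fin (k + m)) :
    padInput x (k + m) (Fin.natAdd n i) = false := by
  simp [padInput]

/-- Coin wires of `x 0^{k+m}` hold `0`. [folklore] -/
theorem padInput_coinWire (x : QReg n) (j : Fin k) : padInput x (k + m) (coinWire n k m j) = false :=
  padInput_natAdd' x _

/-- A basis label is of the form `x y 0^m` iff it agrees with `x 0^{k+m}` off the coin wires,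
and then `y` is its restriction to the coin wires. [folklore] -/
theorem eq_coinInput_iff (x : QReg n) (z : QReg (n + (k + m))) (y : QReg k) :
    z = coinInput x y ↔
      (∀ i, i ∉ Set.range (coinWire n k m) → z i = padInput x (k + m) i) ∧
        z ∘ coinWire n k m = y := by
  constructor
  · rintro rfl
    refine ⟨fun i hi => ?_, funext fun j => by simp⟩
    rw [mem_range_coinWire_iff] at hi
    induction i using Fin.addCases with
    | left i => simp
    | right i =>
      induction i using Fin.addCases with
      | left j => exact absurd ⟨by simp, by simp [j.isLt]⟩ hi
      | right l => simp
  · rintro ⟨h1, rfl⟩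
    funext i
    induction i using Fin.addCases with
    | left i => rw [h1 _ (by rw [mem_range_coinWire_iff]; simp), coinInput_castAdd,
        padInput_castAdd']
    | right i =>
      induction i using Fin.addCases with
      | left j =>
        exact (coinInput_coinWire (m := m) x (z ∘ coinWire n k m) j).symm
      | right l => rw [h1 _ (by rw [mem_range_coinWire_iff]; simp)]; simp

/-- Pointwise form of "the basis states `|x y 0^m⟩`, `y ∈ {0,1}^k`, are exactly the basis
states agreeing with `|x 0^{k+m}⟩` off the coin wires". [folklore] -/
theorem sum_basisState_coinInput_apply (x : QReg n) (z : QReg (n + (k + m))) :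
    (∑ y : QReg k, basisState (coinInput (m := m) x y) z) =
      if (∀ i, i ∉ Set.range (coinWire n k m) → z i = padInput x (k + m) i) then 1 else 0 := by
  by_cases hP : ∀ i, i ∉ Set.range (coinWire n k m) → z i = padInput x (k + m) i
  · rw [if_pos hP]
    simp only [basisState_apply, eq_coinInput_iff]
    rw [Finset.sum_eq_single (z ∘ coinWire n k m)]
    · rw [if_pos ⟨hP, rfl⟩]
    · intro y _ hy; exact if_neg fun h => hy h.2.symm
    · intro h; exact absurd (Finset.mem_univ _) h
  · rw [if_neg hP]
    simp only [basisState_apply, eq_coinInput_iff]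
    exact Finset.sum_eq_zero fun y _ => if_neg fun h => hP h.1

/-- **The coin layer.** The Hadamard coin layer maps `|x⟩|0^k⟩|0^m⟩` to the uniform
superposition `2^{-k/2} ∑_{y ∈ {0,1}^k} |x⟩|y⟩|0^m⟩`. [Bernstein–Vazirani 1997, proof of
Thm. 8.3; Nielsen–Chuang 2010, §1.4.4] [cite: BernsteinVazirani1997, Thm. 8.3 (proof)] -/
theorem hadamardLayer_mulVec_padInput (x : QReg n) :
    (⟨hadamardLayer n k m⟩ : QCircuit cliffordT (n + (k + m))).toMatrix 0 *ᵥ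
        basisState (padInput x (k + m)) =
      invSqrt2 ^ k • ∑ y : QReg k, basisState (coinInput x y) := by
  rw [hadamardLayer, hadamards_mulVec_basisState _ coinWires_nodup _
    (fun i hi => by
      obtain ⟨j, rfl⟩ := (mem_coinWires_iff i).1 hi
      exact padInput_coinWire x j)]
  ext z
  simp only [Pi.smul_apply, Finset.sum_apply, smul_eq_mul, sum_basisState_coinInput_apply,
    mem_coinWires_iff, length_coinWires]
  split_ifs <;> simp

end coins

/-! ### Acceptance probability of a coin family with a classical core -/

section acceptance

variable {p m : ℕ → ℕ} {D : (n : ℕ) → QCircuit cliffordT (n + (p n + m n))}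
  {out : (n : ℕ) → QReg n → QReg (p n) → QReg (n + (p n + m n))}

/-- The circuit of a coin family is the coin layer followed by the classical part. [folklore] -/
theorem coinFamily_circ (n : ℕ) :
    (coinFamily p m D).circ n =
      (⟨hadamardLayer n (p n) (m n)⟩ : QCircuit cliffordT _).append (D n) := rfl

/-- A coin family with oracle-free classical parts is oracle-free. [folklore] -/
theorem coinFamily_isOracleFree (hDfree : ∀ n, (D n).IsOracleFree) :
    (coinFamily p m D).IsOracleFree := by
  intro n g hg
  rw [coinFamily_circ, QCircuit.gates_append, List.mem_append] at hg
  rcases hg with hg | hg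
  · obtain ⟨i, -, rfl⟩ := List.mem_map.1 hg
    exact hOn_isOracleFree i
  · exact hDfree n g hg

/-- **Final superposition** (Bernstein–Vazirani 1997, proof of Thm. 8.3): if the classical part
maps `|x⟩|y⟩|0^m⟩ ↦ |out x y⟩`, the coin family produces `2^{-p(n)/2} ∑_y |out x y⟩` on input
`x`. [cite: BernsteinVazirani1997, Thm. 8.3 (proof)] -/
theorem coinFamily_runOn
    (hD : ∀ n (x : QReg n) (y : QReg (p n)),
      (D n).mat *ᵥ basisState (coinInput x y) = basisState (out n x y))
    (n : ℕ) (x : QReg n) :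
    ((coinFamily p m D).circ n).runOn 0 (basisState (padInput x (p n + m n))) =
      invSqrt2 ^ (p n) • ∑ y : QReg (p n), basisState (out n x y) := by
  rw [QCircuit.runOn, coinFamily_circ, QCircuit.toMatrix_append, ← Matrix.mulVec_mulVec,
    hadamardLayer_mulVec_padInput, Matrix.mulVec_smul, Matrix.mulVec_sum]
  congr 1
  exact Finset.sum_congr rfl fun y _ => hD n x y

/-- The amplitude of `|z⟩` in the final superposition: `2^{-p(n)/2}` if `z = out x y` for some
(necessarily unique) `y`, else `0`. [cite: BernsteinVazirani1997, Thm. 8.3 (proof)] -/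
theorem coinFamily_runOn_apply
    (hD : ∀ n (x : QReg n) (y : QReg (p n)),
      (D n).mat *ᵥ basisState (coinInput x y) = basisState (out n x y))
    (hinj : ∀ n (x : QReg n), Function.Injective (out n x))
    (n : ℕ) (x : QReg n) (z : QReg (n + (p n + m n))) :
    ((coinFamily p m D).circ n).runOn 0 (basisState (padInput x (p n + m n))) z =
      if z ∈ Set.range (out n x) then invSqrt2 ^ (p n) else 0 := by
  rw [coinFamily_runOn hD]
  simp only [Pi.smul_apply, Finset.sum_apply, smul_eq_mul, basisState_apply]
  by_cases hz : z ∈ Set.range (out n x)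
  · obtain ⟨y, rfl⟩ := hz
    rw [if_pos ⟨y, rfl⟩, Finset.sum_eq_single y]
    · simp
    · intro y' _ hy'
      exact if_neg fun h => hy' (hinj n x h).symm
    · intro h; exact absurd (Finset.mem_univ _) h
  · rw [if_neg hz]
    simp only [mul_eq_zero]
    right
    exact Finset.sum_eq_zero fun y _ => if_neg fun h => hz ⟨y, h.symm⟩

/-- `|2^{-k/2}|² = 2^{-k}`. [folklore] -/
theorem norm_invSqrt2_pow_sq (k : ℕ) : ‖invSqrt2 ^ k‖ ^ 2 = (1 / 2 : ℝ) ^ k := by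
  rw [norm_pow, ← pow_mul, mul_comm, pow_mul]
  congr 1
  have h2 : ‖(invSqrt2 : ℂ)‖ = 1 / Real.sqrt 2 := by
    simp [invSqrt2]
  rw [h2, div_pow, Real.sq_sqrt (by norm_num : (0 : ℝ) ≤ 2), one_pow]

/-- Squared amplitude of `|z⟩` in the final superposition, as a counting sum over the coins.
[cite: BernsteinVazirani1997, Thm. 8.3 (proof)] -/
theorem coinFamily_normSq_runOn_apply
    (hD : ∀ n (x : QReg n) (y : QReg (p n)),
      (D n).mat *ᵥ basisState (coinInput x y) = basisState (out n x y))
    (hinj : ∀ n (x : QReg n), Function.Injective (out n x))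
    (n : ℕ) (x : QReg n) (z : QReg (n + (p n + m n))) :
    ‖((coinFamily p m D).circ n).runOn 0 (basisState (padInput x (p n + m n))) z‖ ^ 2 =
      (1 / 2 : ℝ) ^ (p n) * ∑ y : QReg (p n), (if z = out n x y then 1 else 0 : ℝ) := by
  rw [coinFamily_runOn_apply hD hinj]
  by_cases hz : z ∈ Set.range (out n x)
  · rw [if_pos hz, norm_invSqrt2_pow_sq]
    obtain ⟨y, rfl⟩ := hz
    rw [Finset.sum_eq_single y]
    · simp
    · intro y' _ hy'
      exact if_neg fun h => hy' (hinj n _ h).symm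
    · intro h; exact absurd (Finset.mem_univ _) h
  · rw [if_neg hz, Finset.sum_eq_zero fun y _ => if_neg fun h => hz ⟨y, h.symm⟩]
    simp

/-- **Acceptance probability of a coin family** (Bernstein–Vazirani 1997, proof of Thm. 8.3,
last step): the probability of reading `1` on wire `0` after running the coin family on
`|x⟩|0…0⟩` is the fraction of coin strings `y ∈ {0,1}^{p(n)}` whose output label `out x y`
lies in the acceptance event (bit `1` on wire `0`). [cite: BernsteinVazirani1997, Thm. 8.3 (proof)] -/
theorem coinFamily_acceptProb
    (hD : ∀ n (x : QReg n) (y : QReg (p n)),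
      (D n).mat *ᵥ basisState (coinInput x y) = basisState (out n x y))
    (hinj : ∀ n (x : QReg n), Function.Injective (out n x)) (n : ℕ) (x : QReg n) :
    ((coinFamily p m D).circ n).acceptProb 0 x =
      open scoped Classical in
      ((Finset.univ.filter fun y : QReg (p n) =>
          out n x y ∈ QCircuit.acceptEvent (n + (p n + m n))).card : ℝ) / 2 ^ (p n) := by
  classical
  unfold QCircuit.acceptProb
  by_cases hN : 0 < n + (p n + m n)
  · simp only [hN, dif_pos]
    have key : ∀ z : QReg (n + (p n + m n)),
        (if z ⟨0, hN⟩ = true then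
          ‖((coinFamily p m D).circ n).runOn 0 (basisState (padInput x (p n + m n))) z‖ ^ 2
          else 0) =
          (1 / 2 : ℝ) ^ (p n) *
            ∑ y : QReg (p n), (if out n x y = z then (if z ⟨0, hN⟩ = true then 1 else 0) else 0) := by
      intro z
      rw [coinFamily_normSq_runOn_apply hD hinj]
      by_cases hz0 : z ⟨0, hN⟩ = true
      · simp only [hz0, if_true]
        congr 1
        exact Finset.sum_congr rfl fun y _ => by simp only [eq_comm]
      · simp [hz0]
    simp only [key, ← Finset.mul_sum]
    rw [Finset.sum_comm]
    simp only [Finset.sum_ite_eq, Finset.mem_univ, if_true, Finset.sum_boole]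
    rw [mul_comm, one_div, inv_pow, ← div_eq_mul_inv]
    congr 2
    refine congrArg Finset.card (Finset.filter_congr fun y _ => ?_)
    simp [QCircuit.acceptEvent, hN]
  · simp only [hN, dif_neg, not_false_eq_true, Finset.sum_const_zero]
    rw [eq_comm, div_eq_zero_iff]
    left
    norm_cast
    rw [Finset.card_eq_zero, Finset.filter_eq_empty_iff]
    rintro y - ⟨h, -⟩
    omega

/-- `coinFamily_acceptProb` for the family run on a classical input string.
[cite: BernsteinVazirani1997, Thm. 8.3 (proof)] -/
theorem coinFamily_acceptProbOn
    (hD : ∀ n (x : QReg n) (y : QReg (p n)),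
      (D n).mat *ᵥ basisState (coinInput x y) = basisState (out n x y))
    (hinj : ∀ n (x : QReg n), Function.Injective (out n x)) (x : List Bool) :
    (coinFamily p m D).acceptProbOn 0 x =
      open scoped Classical in
      ((Finset.univ.filter fun y : QReg (p x.length) =>
          out x.length x.get y ∈ QCircuit.acceptEvent (x.length + (p x.length + m x.length))).card
        : ℝ) / 2 ^ (p x.length) :=
  coinFamily_acceptProb hD hinj x.length x.get

end acceptance

/-! ### Counting probabilities -/

/-- `uniformProb k E` counted over `{0,1}^k` presented as `Fin k → Bool`. [folklore] -/
theorem uniformProb_eq_card_ofFn (k : ℕ) (E : Set (List Bool)) :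
    uniformProb k E =
      open scoped Classical in
      ((Finset.univ.filter fun y : QReg k => List.ofFn y ∈ E).card : ℝ) / 2 ^ k := by
  classical
  unfold uniformProb
  congr 2
  exact_mod_cast Finset.card_equiv (Equiv.vectorEquivFin Bool k) fun r => by
    simp only [Finset.mem_filter, Finset.mem_univ, true_and]
    rw [show List.ofFn ((Equiv.vectorEquivFin Bool k) r) = r.toList from by
      rw [← List.Vector.toList_ofFn]
      exact congrArg List.Vector.toList (List.Vector.ofFn_get r)]

/-- Complement rule for the counting probability. [folklore] -/
theorem uniformProb_compl (k : ℕ) (E : Set (List Bool)) :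
    uniformProb k Eᶜ = 1 - uniformProb k E := by
  classical
  unfold uniformProb
  have h := Finset.card_filter_add_card_filter_not (s := (Finset.univ : Finset (List.Vector Bool k)))
    (fun r : List.Vector Bool k => r.toList ∈ E)
  rw [Finset.card_univ, card_vector, Fintype.card_bool] at h
  have h2 : (2 : ℝ) ^ k ≠ 0 := by positivity
  rw [eq_sub_iff_add_eq, ← add_div, eq_comm, eq_div_iff h2, one_mul]
  simp only [Set.mem_compl_iff]
  exact_mod_cast (by rw [add_comm]; exact h.symm)

/-! ### The reversible core (named fact) and the reduction of `BPP ⊆ BQP` to it -/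

/-- **Reversible core of `BPP ⊆ BQP`** (Bernstein–Vazirani 1997, proof of Thm. 8.3: the
stationary normal-form QTM `x ↦ x;0^{p(n)}` dovetailed, after the Fourier transform of the
second track, with "a synchronized, normal form version of `M` built according to the
synchronization theorem", producing `∑_y 2^{-p(n)/2} |x⟩|y⟩|M(x;y)⟩`; circuit form:
Arora–Barak 2009, Lemma 10.10 with Cor. 10.11, and Thm. 6.6 for `P ⊆ P-uniform circuits`).

For every `L' ∈ P` and every polynomial `p` there are a work-space bound `m`, *classical
parts* `D n` (oracle-free Clifford+T circuits on `n + p(n) + m(n)` wires) and output labels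
`out n x y ∈ {0,1}^{n+p(n)+m(n)}` such that

* the family "one Hadamard gate on each coin wire `n, …, n+p(n)-1`, then `D n`"
  (`coinFamily`) is polynomial-time uniform (`QCircuitFamily.IsUniform`);
* `D n` maps every basis state `|x⟩|y⟩|0^{m(n)}⟩` (`x ∈ {0,1}^n`, `y ∈ {0,1}^{p(n)}`) to the
  basis state `|out n x y⟩`, injectively in `y` (a reversible deterministic computation; in
  BV97 the output is literally `|x⟩|y⟩|M(x;y)⟩|0…0⟩`);
* wire `0` of `out n x y` — the wire `BQP` measures — holds the bit `[⟨x, y⟩ ∈ L']`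
  (`boolPair`, `QCircuit.acceptEvent`).

This isolates the part of the printed proof that compiles a polynomial-time deterministic
Turing machine into a uniform family of reversible circuits (Bennett; Toffoli gates, which are
exact Clifford+T circuits, Nielsen–Chuang 2010, §4.3, Fig. 4.9), over Mathlib's `TM2` model
underlying `P`; the quantum part of Thm. 8.3 is proved below
(`coinFamily_acceptProbOn`, `BPP_subset_BQP_of_uniformReversibleSimulation`).
[cite: BernsteinVazirani1997, Thm. 8.3 (proof)] -/
def uniformReversibleSimulation : Prop :=
  ∀ L' ∈ P, ∀ p : Polynomial ℕ,
    ∃ (m : ℕ → ℕ) (D : (n : ℕ) → QCircuit cliffordT (n + (p.eval n + m n)))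
      (out : (n : ℕ) → QReg n → QReg (p.eval n) → QReg (n + (p.eval n + m n))),
      (∀ n, (D n).IsOracleFree) ∧
      (coinFamily (fun n => p.eval n) m D).IsUniform ∧
      (∀ n (x : QReg n) (y : QReg (p.eval n)),
          (D n).mat *ᵥ basisState (coinInput x y) = basisState (out n x y)) ∧
      (∀ n (x : QReg n), Function.Injective (out n x)) ∧
      ∀ n (x : QReg n) (y : QReg (p.eval n)),
        out n x y ∈ QCircuit.acceptEvent (n + (p.eval n + m n)) ↔
          boolPair (List.ofFn x) (List.ofFn y) ∈ L'

/-- **`BPP ⊆ BQP` from the reversible core** (Bernstein–Vazirani 1997, Thm. 8.3; Arora–Barak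
2009, Cor. 10.11). Given the reversible simulation `uniformReversibleSimulation`, every
`L ∈ BPP = BP·P` is in `BQP`: with `L' ∈ P` and the coin polynomial `p` witnessing `L ∈ BPP`,
the coin family accepts `x` with probability exactly
`Pr_{y ∈ {0,1}^{p|x|}}[⟨x, y⟩ ∈ L']` (`coinFamily_acceptProbOn`), which is `≥ 2/3` for `x ∈ L`
and `≤ 1/3` for `x ∉ L`. [cite: BernsteinVazirani1997, Thm. 8.3] -/
theorem BPP_subset_BQP_of_uniformReversibleSimulation (hsim : uniformReversibleSimulation) :
    BPP_subset_BQP := by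
  classical
  intro L hL
  simp only [BPP, bp, Set.mem_setOf_eq] at hL
  obtain ⟨L', hL'P, q, hq⟩ := hL
  obtain ⟨m, D, out, hfree, hunif, hD, hinj, hout⟩ := hsim L' hL'P q
  rw [mem_BQP_iff]
  refine ⟨coinFamily (fun n => q.eval n) m D, coinFamily_isOracleFree hfree, hunif, fun x => ?_⟩
  have hacc : (coinFamily (fun n => q.eval n) m D).acceptProbOn 0 x =
      uniformProb (q.eval x.length) {y | boolPair x y ∈ L'} := by
    rw [coinFamily_acceptProbOn hD hinj, uniformProb_eq_card_ofFn]
    congr 2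
    refine congrArg Finset.card (Finset.filter_congr fun y _ => ?_)
    rw [hout, List.ofFn_get, Set.mem_setOf_eq]
  have hqx := hq x
  constructor
  · intro hx
    have hE : {y | boolPair x y ∈ L' ↔ x ∈ L} = {y | boolPair x y ∈ L'} := by
      ext y; simp [hx]
    rw [hacc, ← hE]
    exact hqx
  · intro hx
    have hE : {y | boolPair x y ∈ L' ↔ x ∈ L} = {y | boolPair x y ∈ L'}ᶜ := by
      ext y; simp [hx]
    rw [hE, uniformProb_compl] at hqx
    rw [hacc]
    linarith

end Literature.Computability.QuantumComplexity
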